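import Summits.AtomisticToContinuum.Crystallization.Theorems.PalmUnimodularRigidityLayeredLawsSelectHcpCertificateDefs
import Summits.AtomisticToContinuum.Crystallization.Theorems.PalmUnimodularRigidityLayeredLawsSelectHcpCharts
import Summits.AtomisticToContinuum.Crystallization.Theorems.PalmUnimodularRigidityLayeredLawsSelectHcpLocalCongruence

/-!
# Crux `LayeredLawsSelectHcp` (stmt-AtomisticToContinuum-9226), line `mtp-prestress-split-ergodic-frame`:
# a rooted labelled chart is determined by its values on the twelve star labels

Registered sub-goal `tube_rootedChart_unique` of the crux item (block R3-B of the certificate architecture).  Two rooted labelled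
charts `X, X'` of the same carrier `S` (root at `0`, onto `S`, ideal unit struts ↔ bonds `0 < dist ≤ 28/25`) which agree on the
twelve star labels `hcpStarIdx` are EQUAL.  The argument is purely combinatorial, on the contact graph of the ideal hcp
(`Pᵢ = hcpSite 1 √(2/3)`, touching `dist = 1`):

* `ideal_eq_of_adj_iff`: a site of the ideal hcp is determined by its set of touching sites (two sites with the same neighbours are
  labelled neighbours `nbr z α`, `nbr z β` of a common site `z`, and the rows of the adjacency table of the twelve-point star are
  pairwise distinct, `starAdjT_row_injective`, by `decide`); hence every labelled chart is INJECTIVE (`chart_injective`), and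
  `X = X' ∘ σ` for a self-map `σ` of `ℤ³` preserving touching in both directions, fixing `0` and the twelve star labels;
* `aut_star_step`: if such a `σ` fixes `v` and the twelve neighbours of `v`, and `w` touches `v`, then `σ` fixes the twelve
  neighbours of `w` — the relabelling `π` of the star of `w` induced by `σ` is an injective touching-preserving self-map of
  `hcpStarIdx`, hence an isometry of the ideal star (`stub_localCongruenceStarAut`, landed), and it fixes the label of `v` and the
  labels of the four common neighbours of `v` and `w`; a star label is determined by its distances to a label and the four labels
  touching it (`star_profile_injective`, by `decide` on the precomputed tables `siteQT`/`starAdjT`), so `π = id`;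
* `ideal_aut_eq_id`: walking along the three index axes (unit struts, `dist_ideal_axis`) from `σ 0 = 0` gives `σ = id`, whence
  `X = X'` (`tube_rootedChart_unique`; the `GoodShell` hypothesis of the registered signature is not needed).

All `[folklore]`.
-/

noncomputable section

namespace Summit.AtomisticToContinuum.Crystallization.Theorems.PalmUnimodularRigidity.LayeredLawsSelectHcp

open MeasureTheory Set
open Literature.MathematicalPhysics.StatisticalMechanics Literature.Geometry.DiscreteGeometry
open Summit.AtomisticToContinuum.Crystallization.Theorems.LayeredLawsSelectHcp.Negative.DiracLaws (GoodShell)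

namespace RootedChartUnique

/-! ## Two finite facts about the twelve-point star (by `decide` on the precomputed tables) -/

/-- The rows of the adjacency table of the star are pairwise distinct: no two star labels touch the same star labels. [folklore] -/
theorem starAdjT_row_injective : ∀ m n : Fin 12, (∀ l : Fin 12, starAdjT m l = starAdjT n l) → m = n := by
  decide

/-- **A star label is determined by its ideal distances to a label `m₀` and to the four labels touching `m₀`** (in the integer form
`q₁ + 8 q₂ = 12 · dist²` of the ideal metric): the five reference points affinely span `ℝ³`. [folklore] -/
theorem star_profile_injective : ∀ m₀ n m : Fin 12,
    (siteQT n m₀).1 + 8 * (siteQT n m₀).2 = (siteQT m m₀).1 + 8 * (siteQT m m₀).2 →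
    (∀ l : Fin 12, starAdjT m₀ l = true →
      (siteQT n l).1 + 8 * (siteQT n l).2 = (siteQT m l).1 + 8 * (siteQT m l).2) → n = m := by
  decide

/-! ## The contact graph of the ideal hcp: neighbourhoods determine sites -/

/-- The labelled neighbours of the root are the labels themselves. [folklore] -/
theorem nbr_zero (ε : ℤ × ℤ × ℤ) : nbr 0 ε = ε := by
  unfold nbr
  simp

/-- The labelling `ε ↦ nbr v ε` of the neighbours of the hcp site `v` by the star labels is one-to-one. [folklore] -/
theorem nbr_label_cancel {v ε ε' : ℤ × ℤ × ℤ} (h : nbr v ε = nbr v ε') : ε = ε' := by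
  have h1 : twist v (hcpSite 1 (Real.sqrt (2 / 3)) ε) = twist v (hcpSite 1 (Real.sqrt (2 / 3)) ε') :=
    add_left_cancel (by rw [← hcpSite_nbr, ← hcpSite_nbr, h])
  exact hcpSite_ideal_injective ((twist v).injective h1)

/-- Labelled neighbours of one site are at the ideal distance of their labels (the star of every site is the twisted root star).
[folklore] -/
theorem dist_nbr_nbr (v ε ε' : ℤ × ℤ × ℤ) :
    dist (hcpSite 1 (Real.sqrt (2 / 3)) (nbr v ε)) (hcpSite 1 (Real.sqrt (2 / 3)) (nbr v ε')) =
      dist (hcpSite 1 (Real.sqrt (2 / 3)) ε) (hcpSite 1 (Real.sqrt (2 / 3)) ε') := by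
  rw [hcpSite_nbr, hcpSite_nbr, dist_add_left, LinearIsometryEquiv.dist_map]

/-- Equal ideal distances are equal integer forms `q₁ + 8 q₂` (`dist² = (q₁ + 8 q₂)/12` at `(1, √(2/3))`). [folklore] -/
theorem siteQ_eq_of_dist_eq {x y x' y' : ℤ × ℤ × ℤ}
    (h : dist (hcpSite 1 (Real.sqrt (2 / 3)) x) (hcpSite 1 (Real.sqrt (2 / 3)) y) =
      dist (hcpSite 1 (Real.sqrt (2 / 3)) x') (hcpSite 1 (Real.sqrt (2 / 3)) y')) :
    (siteQ x y).1 + 8 * (siteQ x y).2 = (siteQ x' y').1 + 8 * (siteQ x' y').2 := by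
  have h23 : Real.sqrt (2 / 3) ^ 2 = 2 / 3 := Real.sq_sqrt (by norm_num)
  have hx := hcpSite_dist_sq 1 (Real.sqrt (2 / 3)) x y
  have hx' := hcpSite_dist_sq 1 (Real.sqrt (2 / 3)) x' y'
  rw [h23, one_pow] at hx hx'
  rw [h] at hx
  have : ((siteQ x y).1 : ℝ) + 8 * (siteQ x y).2 = (siteQ x' y').1 + 8 * (siteQ x' y').2 := by linarith
  exact_mod_cast this

/-- Two star labels touching the same star labels are equal. [folklore] -/
theorem star_eq_of_adj_iff {α β : ℤ × ℤ × ℤ} (hα : α ∈ hcpStarIdx) (hβ : β ∈ hcpStarIdx)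
    (h : ∀ γ ∈ hcpStarIdx, (dist (hcpSite 1 (Real.sqrt (2 / 3)) α) (hcpSite 1 (Real.sqrt (2 / 3)) γ) = 1 ↔
      dist (hcpSite 1 (Real.sqrt (2 / 3)) β) (hcpSite 1 (Real.sqrt (2 / 3)) γ) = 1)) : α = β := by
  obtain ⟨m, rfl⟩ := exists_starLab_eq hα
  obtain ⟨n, rfl⟩ := exists_starLab_eq hβ
  rw [starAdjT_row_injective m n fun l => ?_]
  have key := h _ (starLab_mem l)
  rw [dist_ideal_eq_one_iff, dist_ideal_eq_one_iff] at key
  rw [starAdjT_spec, starAdjT_spec, decide_eq_decide]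
  exact key

/-- **A star label is determined by its ideal distances to a label `γ₀` and to the star labels touching `γ₀`.** [folklore] -/
theorem star_eq_of_profile {γ₀ x y : ℤ × ℤ × ℤ} (h₀ : γ₀ ∈ hcpStarIdx) (hx : x ∈ hcpStarIdx) (hy : y ∈ hcpStarIdx)
    (hd₀ : dist (hcpSite 1 (Real.sqrt (2 / 3)) x) (hcpSite 1 (Real.sqrt (2 / 3)) γ₀) =
      dist (hcpSite 1 (Real.sqrt (2 / 3)) y) (hcpSite 1 (Real.sqrt (2 / 3)) γ₀))
    (hd : ∀ l ∈ hcpStarIdx, dist (hcpSite 1 (Real.sqrt (2 / 3)) γ₀) (hcpSite 1 (Real.sqrt (2 / 3)) l) = 1 →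
      dist (hcpSite 1 (Real.sqrt (2 / 3)) x) (hcpSite 1 (Real.sqrt (2 / 3)) l) =
        dist (hcpSite 1 (Real.sqrt (2 / 3)) y) (hcpSite 1 (Real.sqrt (2 / 3)) l)) : x = y := by
  obtain ⟨m₀, rfl⟩ := exists_starLab_eq h₀
  obtain ⟨n, rfl⟩ := exists_starLab_eq hx
  obtain ⟨m, rfl⟩ := exists_starLab_eq hy
  rw [star_profile_injective m₀ n m ?_ fun l hl => ?_]
  · have := siteQ_eq_of_dist_eq hd₀
    rwa [← siteQT_spec, ← siteQT_spec] at this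
  · have h1 : dist (hcpSite 1 (Real.sqrt (2 / 3)) (starLab m₀)) (hcpSite 1 (Real.sqrt (2 / 3)) (starLab l)) = 1 := by
      rw [starAdjT_spec] at hl
      exact (dist_ideal_eq_one_iff _ _).2 (of_decide_eq_true hl)
    have := siteQ_eq_of_dist_eq (hd _ (starLab_mem l) h1)
    rwa [← siteQT_spec, ← siteQT_spec] at this

/-- **A site of the ideal hcp is determined by its touching sites.** [folklore] -/
theorem ideal_eq_of_adj_iff {u w : ℤ × ℤ × ℤ}
    (h : ∀ z, (dist (hcpSite 1 (Real.sqrt (2 / 3)) u) (hcpSite 1 (Real.sqrt (2 / 3)) z) = 1 ↔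
      dist (hcpSite 1 (Real.sqrt (2 / 3)) w) (hcpSite 1 (Real.sqrt (2 / 3)) z) = 1)) : u = w := by
  have m0 : ((0, 1, 0) : ℤ × ℤ × ℤ) ∈ hcpStarIdx := by decide
  have huz : dist (hcpSite 1 (Real.sqrt (2 / 3)) u) (hcpSite 1 (Real.sqrt (2 / 3)) (nbr u (0, 1, 0))) = 1 :=
    (dist_ideal_eq_one_iff_nbr u _).2 ⟨_, m0, rfl⟩
  generalize nbr u (0, 1, 0) = z at huz
  have hwz : dist (hcpSite 1 (Real.sqrt (2 / 3)) w) (hcpSite 1 (Real.sqrt (2 / 3)) z) = 1 := (h z).1 huz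
  obtain ⟨α, hα, hu⟩ := (dist_ideal_eq_one_iff_nbr z u).1 (by rw [dist_comm]; exact huz)
  obtain ⟨β, hβ, hw⟩ := (dist_ideal_eq_one_iff_nbr z w).1 (by rw [dist_comm]; exact hwz)
  subst hu hw
  rw [star_eq_of_adj_iff hα hβ fun γ _ => ?_]
  rw [← dist_nbr_nbr z α γ, ← dist_nbr_nbr z β γ]
  exact h _

/-- **Labelled charts are injective**: under the bond clause, two labels with the same image touch the same sites. [folklore] -/
theorem chart_injective {X : ℤ × ℤ × ℤ → EuclideanSpace ℝ (Fin 3)}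
    (hX : ∀ u w, dist (hcpSite 1 (Real.sqrt (2 / 3)) u) (hcpSite 1 (Real.sqrt (2 / 3)) w) = 1 ↔
      (0 < dist (X u) (X w) ∧ dist (X u) (X w) ≤ 28 / 25)) :
    Function.Injective X := fun u w huw =>
  ideal_eq_of_adj_iff fun z => by rw [hX, hX, huw]

/-! ## Touching-preserving self-maps of the ideal hcp fixing the root star are the identity -/

/-- **The local step.** If `σ : ℤ³ → ℤ³` preserves touching in both directions, fixes `v`, `w` and the twelve neighbours of `v`, and
`w` touches `v`, then `σ` fixes the twelve neighbours of `w`: the induced relabelling of the star of `w` is a touching-preserving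
injection of `hcpStarIdx` into itself, hence an isometry of the ideal star (`stub_localCongruenceStarAut`), fixing the label of `v`
and the labels touching it (the common neighbours of `v` and `w`), hence the identity (`star_eq_of_profile`). [folklore] -/
theorem aut_star_step {σ : ℤ × ℤ × ℤ → ℤ × ℤ × ℤ}
    (hσ : ∀ u z, (dist (hcpSite 1 (Real.sqrt (2 / 3)) (σ u)) (hcpSite 1 (Real.sqrt (2 / 3)) (σ z)) = 1 ↔
      dist (hcpSite 1 (Real.sqrt (2 / 3)) u) (hcpSite 1 (Real.sqrt (2 / 3)) z) = 1))
    {v w : ℤ × ℤ × ℤ} (hvw : dist (hcpSite 1 (Real.sqrt (2 / 3)) v) (hcpSite 1 (Real.sqrt (2 / 3)) w) = 1)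
    (hv : σ v = v) (hw : σ w = w) (hN : ∀ ε ∈ hcpStarIdx, σ (nbr v ε) = nbr v ε) :
    ∀ γ ∈ hcpStarIdx, σ (nbr w γ) = nbr w γ := by
  have hσinj : Function.Injective σ := fun u u' huu' =>
    ideal_eq_of_adj_iff fun z => by rw [← hσ u z, ← hσ u' z, huu']
  -- the induced relabelling of the star of `w`
  have hex : ∀ γ ∈ hcpStarIdx, ∃ δ ∈ hcpStarIdx, σ (nbr w γ) = nbr w δ := fun γ hγ => by
    have h1 : dist (hcpSite 1 (Real.sqrt (2 / 3)) w) (hcpSite 1 (Real.sqrt (2 / 3)) (nbr w γ)) = 1 :=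
      (dist_ideal_eq_one_iff_nbr w _).2 ⟨γ, hγ, rfl⟩
    have h2 := (hσ w (nbr w γ)).2 h1
    rw [hw] at h2
    exact (dist_ideal_eq_one_iff_nbr w _).1 h2
  choose! π hπmem hπeq using hex
  have hπinj : Set.InjOn π ↑hcpStarIdx := fun γ hγ γ' hγ' hγγ' =>
    nbr_label_cancel (hσinj (by rw [hπeq γ hγ, hπeq γ' hγ', hγγ']))
  have hπmaps : Set.MapsTo π ↑hcpStarIdx ↑hcpStarIdx := fun γ hγ => hπmem γ hγ
  have hπadj : ∀ γ ∈ hcpStarIdx, ∀ γ' ∈ hcpStarIdx,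
      (dist (hcpSite 1 (Real.sqrt (2 / 3)) (π γ)) (hcpSite 1 (Real.sqrt (2 / 3)) (π γ')) = 1 ↔
        dist (hcpSite 1 (Real.sqrt (2 / 3)) γ) (hcpSite 1 (Real.sqrt (2 / 3)) γ') = 1) := by
    intro γ hγ γ' hγ'
    rw [← dist_nbr_nbr w (π γ) (π γ'), ← hπeq γ hγ, ← hπeq γ' hγ', hσ, dist_nbr_nbr]
  have hiso := stub_localCongruenceStarAut 1 (Real.sqrt (2 / 3)) π hπinj hπmaps hπadj
  -- the label of `v` in the star of `w` and the labels touching it are fixed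
  obtain ⟨γᵥ, hγᵥ, hvγ⟩ := (dist_ideal_eq_one_iff_nbr w v).1 (by rw [dist_comm]; exact hvw)
  have hfix : ∀ l ∈ hcpStarIdx, σ (nbr w l) = nbr w l → π l = l := fun l hl hl' =>
    nbr_label_cancel (by rw [← hπeq l hl, hl'])
  have hfixv : π γᵥ = γᵥ := hfix γᵥ hγᵥ (by rw [← hvγ, hv])
  have hfixN : ∀ l ∈ hcpStarIdx,
      dist (hcpSite 1 (Real.sqrt (2 / 3)) γᵥ) (hcpSite 1 (Real.sqrt (2 / 3)) l) = 1 → π l = l := by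
    intro l hl hdl
    refine hfix l hl ?_
    have h1 : dist (hcpSite 1 (Real.sqrt (2 / 3)) v) (hcpSite 1 (Real.sqrt (2 / 3)) (nbr w l)) = 1 := by
      rw [hvγ, dist_nbr_nbr]; exact hdl
    obtain ⟨δ, hδ, hδe⟩ := (dist_ideal_eq_one_iff_nbr v _).1 h1
    rw [hδe]
    exact hN δ hδ
  -- so the relabelling is the identity
  intro γ hγ
  rw [hπeq γ hγ]
  congr 1
  refine star_eq_of_profile hγᵥ (hπmem γ hγ) hγ ?_ fun l hl hdl => ?_
  · have := (hiso γ hγ γᵥ hγᵥ).1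
    rwa [hfixv] at this
  · have := (hiso γ hγ l hl).1
    rwa [hfixN l hl hdl] at this

/-- **Propagation.** A self-map of `ℤ³` preserving touching of the ideal hcp in both directions and fixing the root and its twelve
star labels is the identity (the local step along the three index axes, which are unit struts). [folklore] -/
theorem ideal_aut_eq_id {σ : ℤ × ℤ × ℤ → ℤ × ℤ × ℤ}
    (hσ : ∀ u z, (dist (hcpSite 1 (Real.sqrt (2 / 3)) (σ u)) (hcpSite 1 (Real.sqrt (2 / 3)) (σ z)) = 1 ↔
      dist (hcpSite 1 (Real.sqrt (2 / 3)) u) (hcpSite 1 (Real.sqrt (2 / 3)) z) = 1))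
    (h0 : σ 0 = 0) (hstar : ∀ ε ∈ hcpStarIdx, σ ε = ε) : ∀ u, σ u = u := by
  -- one bond step
  have step : ∀ v w, dist (hcpSite 1 (Real.sqrt (2 / 3)) v) (hcpSite 1 (Real.sqrt (2 / 3)) w) = 1 →
      (σ v = v ∧ ∀ ε ∈ hcpStarIdx, σ (nbr v ε) = nbr v ε) →
      (σ w = w ∧ ∀ ε ∈ hcpStarIdx, σ (nbr w ε) = nbr w ε) := by
    rintro v w hvw ⟨hv, hN⟩
    obtain ⟨ε₀, hε₀, hwe⟩ := (dist_ideal_eq_one_iff_nbr v w).1 hvw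
    have hw : σ w = w := by rw [hwe]; exact hN ε₀ hε₀
    exact ⟨hw, aut_star_step hσ hvw hv hw hN⟩
  have base : σ ((0 : ℤ), 0, 0) = ((0 : ℤ), 0, 0) ∧ ∀ ε ∈ hcpStarIdx, σ (nbr ((0 : ℤ), 0, 0) ε) = nbr ((0 : ℤ), 0, 0) ε :=
    ⟨h0, fun ε hε => by rw [show (((0 : ℤ), 0, 0) : ℤ × ℤ × ℤ) = 0 from rfl, nbr_zero]; exact hstar ε hε⟩
  -- walk along the axes
  have hk : ∀ k : ℤ, σ (k, 0, 0) = (k, 0, 0) ∧ ∀ ε ∈ hcpStarIdx, σ (nbr (k, 0, 0) ε) = nbr (k, 0, 0) ε := by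
    intro k
    induction k using Int.induction_on with
    | zero => exact base
    | succ n ih => exact step _ _ (dist_ideal_axis ((n : ℤ), 0, 0)).1 ih
    | pred n ih => exact step _ _ (dist_ideal_axis (-(n : ℤ), 0, 0)).2.1 ih
  have hki : ∀ k i : ℤ, σ (k, i, 0) = (k, i, 0) ∧ ∀ ε ∈ hcpStarIdx, σ (nbr (k, i, 0) ε) = nbr (k, i, 0) ε := by
    intro k i
    induction i using Int.induction_on with
    | zero => exact hk k
    | succ n ih => exact step _ _ (dist_ideal_axis (k, (n : ℤ), 0)).2.2.1 ih
    | pred n ih => exact step _ _ (dist_ideal_axis (k, -(n : ℤ), 0)).2.2.2.1 ih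
  intro u
  obtain ⟨k, i, j⟩ := u
  suffices H : σ (k, i, j) = (k, i, j) ∧ ∀ ε ∈ hcpStarIdx, σ (nbr (k, i, j) ε) = nbr (k, i, j) ε from H.1
  induction j using Int.induction_on with
  | zero => exact hki k i
  | succ n ih => exact step _ _ (dist_ideal_axis (k, i, (n : ℤ))).2.2.2.2.1 ih
  | pred n ih => exact step _ _ (dist_ideal_axis (k, i, -(n : ℤ))).2.2.2.2.2 ih

end RootedChartUnique

open RootedChartUnique in
/-- **Registered sub-goal `tube_rootedChart_unique` (R3-B) — a rooted labelled chart is determined by its values on the star.**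
Two rooted labelled charts of the same carrier `S` which agree on the twelve star labels `hcpStarIdx` are equal: charts are
injective (`chart_injective`), so `X = X' ∘ σ` for a touching-preserving self-map `σ` of the ideal hcp fixing the root and the star
labels, and such a `σ` is the identity (`ideal_aut_eq_id`).  (The `GoodShell` hypothesis is not used.) [folklore] -/
theorem tube_rootedChart_unique : ∀ S : Set (EuclideanSpace ℝ (Fin 3)), ∀ X X' : ℤ × ℤ × ℤ → EuclideanSpace ℝ (Fin 3), (∀ x ∈ S, GoodShell S x) → IsRootedChart S X → IsRootedChart S X' → (∀ v ∈ hcpStarIdx, X v = X' v) → X = X' := by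
  intro S X X' _ hX hX' hagree
  obtain ⟨hX0, hXS, -, hch⟩ := hX
  obtain ⟨hX0', -, hSX', hch'⟩ := hX'
  have hinj' : Function.Injective X' := chart_injective hch'
  choose σ hσ using fun u => hSX' (X u) (hXS u)
  have hadj : ∀ u z, (dist (hcpSite 1 (Real.sqrt (2 / 3)) (σ u)) (hcpSite 1 (Real.sqrt (2 / 3)) (σ z)) = 1 ↔
      dist (hcpSite 1 (Real.sqrt (2 / 3)) u) (hcpSite 1 (Real.sqrt (2 / 3)) z) = 1) := fun u z => by
    rw [hch', hσ, hσ, hch]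
  have h0 : σ 0 = 0 := hinj' (by rw [hσ, hX0, hX0'])
  have hs : ∀ ε ∈ hcpStarIdx, σ ε = ε := fun ε hε => hinj' (by rw [hσ, hagree ε hε])
  funext u
  rw [← hσ u, ideal_aut_eq_id hadj h0 hs u]

end Summit.AtomisticToContinuum.Crystallization.Theorems.PalmUnimodularRigidity.LayeredLawsSelectHcp

end
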